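import Literature.MathematicalPhysics.QuantumFieldTheory.Balaban1983to89.B9CubeLettersInvReadDictBMajorants
import Literature.MathematicalPhysics.QuantumFieldTheory.Balaban1983to89.B9CubeLettersInvWriteDictB
import Literature.MathematicalPhysics.QuantumFieldTheory.Balaban1983to89.B9Thm314WholeExpansionReads
import Literature.MathematicalPhysics.QuantumFieldTheory.Balaban1983to89.B9SectBStepsKSCU

/-!
# Balaban [B9], Thm 3.3 p. 399 with (3.42) p. 397, [4] (2.51) p. 232 — THE (3.42) READING DICTIONARY OF NODE 00's BOND-SECTOR FAMILY
# `Node00.kernelFamilyB i B cfg O par` (the bond-sector twin of def-Y's `Node00.OpsYRead342` §4): the (3.42) block at a configuration ⇒ the four POINTWISE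
# bounds of `O(V)`, `∇_{V,ν}O(V)`, `O(V)∇*_{V,ν}`, `Δ_V O(V)` on product inputs `J ⊗ E`, `‖E‖ ≦ 1`, and ⇒ the four [4]-(2.51) BLOCK MAJORANTS of the real-coordinate
# letters `conj b O(V)`, `conj b (∇_{V,ν} ∘ O(V))`, `conj b (O(V) ∘ ∇*_{V,ν})`, `conj b (Δ_V ∘ O(V))` on the bond carrier `FBondY × ι` (block map `ι_B ∘ blkV1`); and the
# same for the coded bond reading `KACU` of the Sect.-B step of record (R13-U1): READ at a base, WRITE at a coded product (pub-ymgap N06 row 13, G side,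
# first brick of the instance: the `readG342 ∕ writeG342` dictionary of the bond sector in def-Y's letters)

T. Bałaban, *Propagators for lattice gauge theories in a background field*, Commun. Math. Phys. **99** (1985) 389–434
[`Balaban1985BackgroundPropagators`, "B9"]; [4] = T. Bałaban, *Propagators and renormalization transformations for lattice gauge
theories. II*, Commun. Math. Phys. **96** (1984) 223–250 [`Balaban1984PropagatorsII`].

statement-level skeleton of published theorems with citation tags; proofs where landed; nothing here is a claim about the
Yang–Mills mass gap

WHAT.  §2 ★ READ POINTWISE: from
`EBlock (kernelFamilyB i B cfg O par) B₀ δ U₁` (def-Y's product-class (3.42) block at `V = cfg U₁`), for every `J` supported in `Δ(βy′)`, `‖E‖ ≦ 1` and bond `x`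
in `Δ(βy)`: `‖(O(V)(J ⊗ E))(x)‖ ≦ B₀ℓ(y)²e^{−δd(y,y′)}|J|`, `‖(∇_{V,ν}O(V)(J ⊗ E))(x)‖`, `‖(O(V)∇*_{V,ν}(J ⊗ E))(x)‖ ≦ B₀ℓ(y)e^{−δd}|J|`, `‖(Δ_VO(V)(J ⊗ E))(x)‖ ≦
B₀e^{−δd}|J|` (the sup over the unit ball is finite-dimensionally bounded by p21's class device `B9CubeLettersInvReadDictB.supInB_O_le_unif` etc.).  §3 ★★ READ
AS MAJORANTS: the four block majorants `M₂Σ_j‖b_j‖·B₀·ℓ(a)^{2,1,1,0}·e^{−δd(a,a′)}` of the conj-`b` letters over the bond carrier, by lit-balaban's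
`B9Thm310CommutatorBound389BMajorant.hasMajorant_conj_of_ball_boundB` (corner-free members: a section `ι_B` of `β`).  §4 ★★ the same four majorants for the
CODED bond reading `KACU G x OA parB C37 C38` of `B9SectBCodedReadingsU` at a base configuration (`KACU_members_base`: at the base the U-letter reading
IS def-Y's one-configuration reading `kernelFamilyB`) — the `h342X` inputs of r06's letter-free G-step `B9Ineq385VG.gExt_leftEntry_of_386` ∕ the `readG342`
half of `B9SectBGFrameV3.GFrame₃` in def-Y's own letters.  §5 ★★ WRITE for `KACU` at a coded product: `KACU_e_prod_eq` (at `prod U a` the (3.42) members of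
`KACU` ARE those of def-Y's one-configuration reading of the CONSTANT letter `OA(W)`, `W = e^{iηa}·U`, through `baseY` — `rfl`) and `writeG342Y_KACU`: block
majorants of `conj b G`, `conj b D_ν * conj b G`, `conj b G * conj b D*_ν`, `conj b L * conj b G` (`G, D_ν, D*_ν, L` agreeing pointwise with `OA(W)`, `∇_{U,ν}`,
`∇*_{U,ν}`, `Δ_U` — differences at the BASE, operator at the PRODUCT, the U-letter convention R13-U1) ⇒ `EBlock (KACU …) (M₂Σ‖b‖·B_c) δ (prod U a)`, SAME rate
(p21's writer `B9CubeLettersInvWriteDictB.eBlock_kernelFamilyBInv_of_hasMajorant` + the class ⇒ product dictionary).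

HONEST SCOPE.  Sup bookkeeping and finite-dimensional linear algebra over def-Y's definitions; the (3.42) block is the HYPOTHESIS; SAME rate `δ`;
constants `M₂Σ_j‖b_j‖·B₀` (READ) ∕ `M₂Σ_j‖b_j‖·B_c` (WRITE).  The Hölder ∕ L² ∕ (3.47) members of `KACU` are NOT in this file.  Count-neutral; no summit ∕ sub-problem statement is proved; N06 is not discharged; nothing continuum ∕ OS ∕ mass-gap ∕ Clay.  No `sorry`, no
`axiom`, no `… : Prop` fact, no `instance`, no `notation`, no `def`.  Seat dag-n06-c g12, 2026-08-28; `--supports stmt-QuantumFields-27364`.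

RELATED IN THE TREE, NOT DUPLICATED.  def-Y `Node00.OpsYRead342` (the SITE-sector twin, `kernelFamilyS`); p21 `B9CubeLettersInvReadDictB` (READ for the
test-class family `kernelFamilyBInv` — devices §1–§2 used BY NAME; its §4 is over the class `TestY`, ours over def-Y's product class); lit-balaban
`B9Thm310CommutatorBound389BMajorant` (the ball-bound ⇒ majorant device on the bond carrier, used BY NAME); p21 `B9CubeLettersInvReadDictBMajorants` (the four majorants
for the TEST-CLASS family `kernelFamilyBInv` — the stronger hypothesis; ours start from def-Y's product-class block, which is what `KACU` delivers; its `cdB_smul` ∕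
`cdsB_smul` ∕ `lapB_smul` used BY NAME); dag-n06-c g10 `B9SectBStepsKSCU` (`KACU_members_base`).
-/

noncomputable section

namespace Literature.MathematicalPhysics.QuantumFieldTheory.Balaban1983to89.B9SectBGReadY

open Node00
open B6GlobalChartV1 (blkV1)
open B6Ineq2142KLevelV1 (β)
open B6KLevelCensusIndexV1 (KIdx)
open B6RandomWalk (HasMajorant hasMajorant_mono)
open B9Thm34Ext (toB6)
open B9FromB6 (EBlock)
open B9GeoNormsKLevelV1 (geo9K)
open B9Eq352DivFormLetters (conj)
open B9CoReadingCoords (cdBₗ cdsBₗ lapBₗ cdBₗ_apply cdsBₗ_apply lapBₗ_apply)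
open B9CubeLettersInvReadings (testYOfBall)
open B9CubeLettersInvReadDictB (norm_le_supInB supInB_O_le_unif iSup_supInB_cdB_O_le_unif iSup_supInB_O_cdsB_le_unif supInB_lapB_O_le_unif le_iSup_fin
  eBlock_kernelFamilyB_of_eBlockInvB)
open B9CubeLettersInvWriteDictB (eBlock_kernelFamilyBInv_of_hasMajorant)
open B9SectBGpReadingsY (baseY)
open B9SectBGpLettersY (decY)
open B9Thm310CommutatorBound389BMajorant (hasMajorant_conj_of_ball_boundB)
open B9CubeLettersInvReadDictBMajorants (cdB_smul cdsB_smul lapB_smul)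
open B9Thm314WholeExpansionReads (le_iSup_ball)
open B9PinMembersKLevelV1 (MemberY geo9Y bg9Y)
open B9Eq360DeltaPrimeAY (AfldY)
open B9SectBGpFrameCodedY (codingYx codingYx_dec)
open B9SectBGpLettersY (decY_base)
open B9SectBCodedCarrier (pullK pullK_e)
open B9SectBCodedReadingsU (KACU)
open B9SectBStepsKSCU (KACU_members_base)

variable {d ℓ : ℕ} {hd : 1 ≤ d + 1} {hL : Odd (ℓ + 1) ∧ 1 < ℓ + 1} {b₀ b₁ : ℝ}
variable {𝔸 : Type} [NormedRing 𝔸] [NormedAlgebra ℂ 𝔸] [CompleteSpace 𝔸]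
variable {ι : Type} [Fintype ι]
variable (i : KIdx d ℓ hd hL b₀ b₁) (b : Module.Basis ι ℝ 𝔸)

/-! ## §2 READ at def-Y's bond entries, pointwise: `EBlock (kernelFamilyB …) B₀ δ U₁` ⇒ the four bounds at `cfg U₁` -/

section Read

variable {B : B9.Backgrounds} (cfg : B.Cfg → CfgY 𝔸 i) (O : BondOpY 𝔸 i) (par : BondParY 𝔸 i) {B₀ δ : ℝ} {U₁ : B.Cfg}

/-- ★ entry 0 READ pointwise: `‖(O(V)(J ⊗ E))(x)‖ ≦ B₀ℓ(y)²e^{−δd(y,y′)}|J|` for `‖E‖ ≦ 1`, `supp J ⊂ Δ(βy′)`, `x ∈ Δ(βy)`.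
[cite: Balaban1985BackgroundPropagators, Thm 3.3 p.399 with (3.42) p.397 (first member)] -/
theorem norm_O_le_of_eBlockB (hE : EBlock (kernelFamilyB i B cfg O par) B₀ δ U₁)
    {M₂ : ℝ} (hM₂ : 0 ≤ M₂) (hrepr : ∀ (v : 𝔸) (j : ι), |b.repr v j| ≤ M₂ * ‖v‖)
    (J : FBondY i → ℝ) (y y' : IBondY i) (hs : (geo9K i).suppIn (Sum.inr J) y') {E : 𝔸} (hE1 : ‖E‖ ≤ 1)
    {x : FBondY i} (hx : blkV1 i.hN i.D x = β i.hN i.D i.hk y) :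
    ‖O (cfg U₁) (liftY J E) x‖ ≤ B₀ * (geo9K i).len y ^ 2 * Real.exp (-(δ * (geo9K i).dist y y')) * (geo9K i).supNorm (Sum.inr J) := by
  have h := hE 0 (Sum.inr J) y y' hs
  have hK : (kernelFamilyB i B cfg O par).e 0 U₁ (Sum.inr J) y =
      ⨆ E' : BallY 𝔸, supInB i (β i.hN i.D i.hk y) (O (cfg U₁) (liftY J (E' : 𝔸))) := rfl
  have hp : B9.pref4 ((geo9K i).len y) 0 = (geo9K i).len y ^ 2 := rfl
  rw [hK, hp] at h
  refine le_trans ?_ h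
  have hbd : ∀ E' : BallY 𝔸, supInB i (β i.hN i.D i.hk y) (O (cfg U₁) (liftY J (E' : 𝔸))) ≤
      M₂ * ∑ z, |J z| * ∑ j, ∑ w', ‖((O (cfg U₁)).restrictScalars ℝ) (deltaY z (b j)) w'‖ := fun E' =>
    supInB_O_le_unif i b hM₂ hrepr O (cfg U₁) J (testYOfBall J E') _
  exact (norm_le_supInB i _ (O (cfg U₁) (liftY J E)) hx).trans (le_iSup_ball ⟨_, hbd⟩ ⟨E, mem_closedBall_zero_iff.2 hE1⟩)

/-- ★ entry 1 READ pointwise: `‖(∇_{V,ν}O(V)(J ⊗ E))(x)‖ ≦ B₀ℓ(y)e^{−δd(y,y′)}|J|`. [cite: Balaban1985BackgroundPropagators, Thm 3.3 p.399 with (3.42) p.397 (second member)] -/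
theorem norm_cdB_O_le_of_eBlockB (hE : EBlock (kernelFamilyB i B cfg O par) B₀ δ U₁)
    {M₂ : ℝ} (hM₂ : 0 ≤ M₂) (hrepr : ∀ (v : 𝔸) (j : ι), |b.repr v j| ≤ M₂ * ‖v‖)
    (J : FBondY i → ℝ) (y y' : IBondY i) (hs : (geo9K i).suppIn (Sum.inr J) y') {E : 𝔸} (hE1 : ‖E‖ ≤ 1)
    {x : FBondY i} (ν : Fin (d + 1)) (hx : blkV1 i.hN i.D x = β i.hN i.D i.hk y) :
    ‖cdB i (cfg U₁) ν (O (cfg U₁) (liftY J E)) x‖ ≤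
      B₀ * (geo9K i).len y * Real.exp (-(δ * (geo9K i).dist y y')) * (geo9K i).supNorm (Sum.inr J) := by
  have h := hE 1 (Sum.inr J) y y' hs
  have hK : (kernelFamilyB i B cfg O par).e 1 U₁ (Sum.inr J) y =
      ⨆ E' : BallY 𝔸, ⨆ ν' : Fin (d + 1), supInB i (β i.hN i.D i.hk y) (cdB i (cfg U₁) ν' (O (cfg U₁) (liftY J (E' : 𝔸)))) := rfl
  have hp : B9.pref4 ((geo9K i).len y) 1 = (geo9K i).len y := rfl
  rw [hK, hp] at h
  refine le_trans ?_ h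
  have hbd : ∀ E' : BallY 𝔸, (⨆ ν' : Fin (d + 1), supInB i (β i.hN i.D i.hk y) (cdB i (cfg U₁) ν' (O (cfg U₁) (liftY J (E' : 𝔸))))) ≤
      ∑ ν' : Fin (d + 1), M₂ * ∑ z, |J z| * ∑ j, ∑ w', ‖(cdBₗ i (cfg U₁) ν' ∘ₗ (O (cfg U₁)).restrictScalars ℝ) (deltaY z (b j)) w'‖ := fun E' =>
    iSup_supInB_cdB_O_le_unif i b hM₂ hrepr O (cfg U₁) J (testYOfBall J E') _
  refine (norm_le_supInB i _ (cdB i (cfg U₁) ν (O (cfg U₁) (liftY J E))) hx).trans ?_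
  refine (le_iSup_fin (fun ν' : Fin (d + 1) => supInB i (β i.hN i.D i.hk y) (cdB i (cfg U₁) ν' (O (cfg U₁) (liftY J E)))) ν).trans ?_
  exact le_iSup_ball ⟨_, hbd⟩ ⟨E, mem_closedBall_zero_iff.2 hE1⟩

/-- ★ entry 2 READ pointwise: `‖(O(V)∇*_{V,ν}(J ⊗ E))(x)‖ ≦ B₀ℓ(y)e^{−δd(y,y′)}|J|`. [cite: Balaban1985BackgroundPropagators, Thm 3.3 p.399 with (3.42) p.397 (third member)] -/
theorem norm_O_cdsB_le_of_eBlockB (hE : EBlock (kernelFamilyB i B cfg O par) B₀ δ U₁)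
    {M₂ : ℝ} (hM₂ : 0 ≤ M₂) (hrepr : ∀ (v : 𝔸) (j : ι), |b.repr v j| ≤ M₂ * ‖v‖)
    (J : FBondY i → ℝ) (y y' : IBondY i) (hs : (geo9K i).suppIn (Sum.inr J) y') {E : 𝔸} (hE1 : ‖E‖ ≤ 1)
    {x : FBondY i} (ν : Fin (d + 1)) (hx : blkV1 i.hN i.D x = β i.hN i.D i.hk y) :
    ‖O (cfg U₁) (cdsB i (cfg U₁) ν (liftY J E)) x‖ ≤
      B₀ * (geo9K i).len y * Real.exp (-(δ * (geo9K i).dist y y')) * (geo9K i).supNorm (Sum.inr J) := by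
  have h := hE 2 (Sum.inr J) y y' hs
  have hK : (kernelFamilyB i B cfg O par).e 2 U₁ (Sum.inr J) y =
      ⨆ E' : BallY 𝔸, ⨆ ν' : Fin (d + 1), supInB i (β i.hN i.D i.hk y) (O (cfg U₁) (cdsB i (cfg U₁) ν' (liftY J (E' : 𝔸)))) := rfl
  have hp : B9.pref4 ((geo9K i).len y) 2 = (geo9K i).len y := rfl
  rw [hK, hp] at h
  refine le_trans ?_ h
  have hbd : ∀ E' : BallY 𝔸, (⨆ ν' : Fin (d + 1), supInB i (β i.hN i.D i.hk y) (O (cfg U₁) (cdsB i (cfg U₁) ν' (liftY J (E' : 𝔸))))) ≤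
      ∑ ν' : Fin (d + 1), M₂ * ∑ z, |J z| * ∑ j, ∑ w', ‖((O (cfg U₁)).restrictScalars ℝ ∘ₗ cdsBₗ i (cfg U₁) ν') (deltaY z (b j)) w'‖ := fun E' =>
    iSup_supInB_O_cdsB_le_unif i b hM₂ hrepr O (cfg U₁) J (testYOfBall J E') _
  refine (norm_le_supInB i _ (O (cfg U₁) (cdsB i (cfg U₁) ν (liftY J E))) hx).trans ?_
  refine (le_iSup_fin (fun ν' : Fin (d + 1) => supInB i (β i.hN i.D i.hk y) (O (cfg U₁) (cdsB i (cfg U₁) ν' (liftY J E)))) ν).trans ?_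
  exact le_iSup_ball ⟨_, hbd⟩ ⟨E, mem_closedBall_zero_iff.2 hE1⟩

/-- ★ entry 3 READ pointwise: `‖(Δ_VO(V)(J ⊗ E))(x)‖ ≦ B₀e^{−δd(y,y′)}|J|`. [cite: Balaban1985BackgroundPropagators, Thm 3.3 p.399 with (3.42) p.397 (fourth member)] -/
theorem norm_lapB_O_le_of_eBlockB (hE : EBlock (kernelFamilyB i B cfg O par) B₀ δ U₁)
    {M₂ : ℝ} (hM₂ : 0 ≤ M₂) (hrepr : ∀ (v : 𝔸) (j : ι), |b.repr v j| ≤ M₂ * ‖v‖)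
    (J : FBondY i → ℝ) (y y' : IBondY i) (hs : (geo9K i).suppIn (Sum.inr J) y') {E : 𝔸} (hE1 : ‖E‖ ≤ 1)
    {x : FBondY i} (hx : blkV1 i.hN i.D x = β i.hN i.D i.hk y) :
    ‖lapB i (cfg U₁) (O (cfg U₁) (liftY J E)) x‖ ≤
      B₀ * 1 * Real.exp (-(δ * (geo9K i).dist y y')) * (geo9K i).supNorm (Sum.inr J) := by
  have h := hE 3 (Sum.inr J) y y' hs
  have hK : (kernelFamilyB i B cfg O par).e 3 U₁ (Sum.inr J) y =
      ⨆ E' : BallY 𝔸, supInB i (β i.hN i.D i.hk y) (lapB i (cfg U₁) (O (cfg U₁) (liftY J (E' : 𝔸)))) := rfl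
  have hp : B9.pref4 ((geo9K i).len y) 3 = 1 := rfl
  rw [hK, hp] at h
  refine le_trans ?_ h
  have hbd : ∀ E' : BallY 𝔸, supInB i (β i.hN i.D i.hk y) (lapB i (cfg U₁) (O (cfg U₁) (liftY J (E' : 𝔸)))) ≤
      M₂ * ∑ z, |J z| * ∑ j, ∑ w', ‖(lapBₗ i (cfg U₁) ∘ₗ (O (cfg U₁)).restrictScalars ℝ) (deltaY z (b j)) w'‖ := fun E' =>
    supInB_lapB_O_le_unif i b hM₂ hrepr O (cfg U₁) J (testYOfBall J E') _
  exact (norm_le_supInB i _ (lapB i (cfg U₁) (O (cfg U₁) (liftY J E))) hx).trans (le_iSup_ball ⟨_, hbd⟩ ⟨E, mem_closedBall_zero_iff.2 hE1⟩)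

/-! ## §3 READ as block majorants of the conj-`b` letters on the bond carrier `FBondY × ι` -/

variable [Fintype (geo9K i).Site] {Rr : ℝ} {Hp : Prop}

/-- ★★ **READ, entry 0 ⇒ the majorant of `conj b O(V)`** with constant `M₂(Σ‖b_j‖)B₀`, profile `ℓ(a)²`, SAME rate `δ` (corner-free: a section `ι_B` of `β`).
[cite: Balaban1985BackgroundPropagators, Thm 3.3 p.399 with (3.42) p.397 (first member); Balaban1984PropagatorsII, (2.51) p.232] -/
theorem hasMajorant_conj_O_of_eBlockB (hE : EBlock (kernelFamilyB i B cfg O par) B₀ δ U₁) (hB₀ : 0 ≤ B₀)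
    (ιB : BlkY i → IBondY i) (hι : ∀ s, β i.hN i.D i.hk (ιB s) = s)
    {M₂ : ℝ} (hM₂ : 0 ≤ M₂) (hrepr : ∀ (v : 𝔸) (j : ι), |b.repr v j| ≤ M₂ * ‖v‖) :
    HasMajorant (g := toB6 (geo9K i) Rr Hp) (fun p : FBondY i × ι => ιB (blkV1 i.hN i.D p.1)) (conj b ((O (cfg U₁)).restrictScalars ℝ))
      (fun a a' => M₂ * (∑ j, ‖b j‖) * (B₀ * (geo9K i).len a ^ 2 * Real.exp (-(δ * (geo9K i).dist a a')))) :=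
  hasMajorant_conj_of_ball_boundB (Rr := Rr) (Hp := Hp) i b ((O (cfg U₁)).restrictScalars ℝ) (fun c Λ => (O (cfg U₁)).map_smul c Λ) ιB hι
    hM₂ hrepr (fun a a' => B₀ * (geo9K i).len a ^ 2 * Real.exp (-(δ * (geo9K i).dist a a')))
    (fun _ _ => mul_nonneg (mul_nonneg hB₀ (sq_nonneg _)) (Real.exp_pos _).le)
    fun J y y' hs _ hE1 _ hx => norm_O_le_of_eBlockB i b cfg O par hE hM₂ hrepr J y y' hs hE1 hx

/-- ★★ **READ, entry 1 ⇒ the majorant of `conj b (∇_{V,ν} ∘ O(V))`**, profile `ℓ(a)`, SAME rate. [cite: Balaban1985BackgroundPropagators, Thm 3.3 p.399 with (3.42) p.397 (second member); Balaban1984PropagatorsII, (2.51) p.232] -/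
theorem hasMajorant_conj_cdB_O_of_eBlockB (hE : EBlock (kernelFamilyB i B cfg O par) B₀ δ U₁) (hB₀ : 0 ≤ B₀)
    (ιB : BlkY i → IBondY i) (hι : ∀ s, β i.hN i.D i.hk (ιB s) = s)
    {M₂ : ℝ} (hM₂ : 0 ≤ M₂) (hrepr : ∀ (v : 𝔸) (j : ι), |b.repr v j| ≤ M₂ * ‖v‖) (ν : Fin (d + 1)) :
    HasMajorant (g := toB6 (geo9K i) Rr Hp) (fun p : FBondY i × ι => ιB (blkV1 i.hN i.D p.1))
      (conj b (cdBₗ i (cfg U₁) ν ∘ₗ (O (cfg U₁)).restrictScalars ℝ))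
      (fun a a' => M₂ * (∑ j, ‖b j‖) * (B₀ * (geo9K i).len a * Real.exp (-(δ * (geo9K i).dist a a')))) :=
  hasMajorant_conj_of_ball_boundB (Rr := Rr) (Hp := Hp) i b (cdBₗ i (cfg U₁) ν ∘ₗ (O (cfg U₁)).restrictScalars ℝ)
    (fun c Λ => by
      rw [LinearMap.comp_apply, LinearMap.comp_apply, LinearMap.restrictScalars_apply, LinearMap.restrictScalars_apply, map_smul, cdBₗ_apply,
        cdBₗ_apply, cdB_smul])
    ιB hι hM₂ hrepr (fun a a' => B₀ * (geo9K i).len a * Real.exp (-(δ * (geo9K i).dist a a')))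
    (fun a a' => mul_nonneg (mul_nonneg hB₀ (B9GeoLemma21KLevelV1.geo9K_len_pos i a).le) (Real.exp_pos _).le)
    fun J y y' hs _ hE1 _ hx => by
      rw [LinearMap.comp_apply, cdBₗ_apply]
      exact norm_cdB_O_le_of_eBlockB i b cfg O par hE hM₂ hrepr J y y' hs hE1 ν hx

/-- ★★ **READ, entry 2 ⇒ the majorant of `conj b (O(V) ∘ ∇*_{V,ν})`**, profile `ℓ(a)`, SAME rate. [cite: Balaban1985BackgroundPropagators, Thm 3.3 p.399 with (3.42) p.397 (third member); Balaban1984PropagatorsII, (2.51) p.232] -/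
theorem hasMajorant_conj_O_cdsB_of_eBlockB (hE : EBlock (kernelFamilyB i B cfg O par) B₀ δ U₁) (hB₀ : 0 ≤ B₀)
    (ιB : BlkY i → IBondY i) (hι : ∀ s, β i.hN i.D i.hk (ιB s) = s)
    {M₂ : ℝ} (hM₂ : 0 ≤ M₂) (hrepr : ∀ (v : 𝔸) (j : ι), |b.repr v j| ≤ M₂ * ‖v‖) (ν : Fin (d + 1)) :
    HasMajorant (g := toB6 (geo9K i) Rr Hp) (fun p : FBondY i × ι => ιB (blkV1 i.hN i.D p.1))
      (conj b ((O (cfg U₁)).restrictScalars ℝ ∘ₗ cdsBₗ i (cfg U₁) ν))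
      (fun a a' => M₂ * (∑ j, ‖b j‖) * (B₀ * (geo9K i).len a * Real.exp (-(δ * (geo9K i).dist a a')))) :=
  hasMajorant_conj_of_ball_boundB (Rr := Rr) (Hp := Hp) i b ((O (cfg U₁)).restrictScalars ℝ ∘ₗ cdsBₗ i (cfg U₁) ν)
    (fun c Λ => by
      rw [LinearMap.comp_apply, LinearMap.comp_apply, LinearMap.restrictScalars_apply, LinearMap.restrictScalars_apply, cdsBₗ_apply, cdsBₗ_apply,
        cdsB_smul, map_smul])
    ιB hι hM₂ hrepr (fun a a' => B₀ * (geo9K i).len a * Real.exp (-(δ * (geo9K i).dist a a')))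
    (fun a a' => mul_nonneg (mul_nonneg hB₀ (B9GeoLemma21KLevelV1.geo9K_len_pos i a).le) (Real.exp_pos _).le)
    fun J y y' hs _ hE1 _ hx => by
      rw [LinearMap.comp_apply, LinearMap.restrictScalars_apply, cdsBₗ_apply]
      exact norm_O_cdsB_le_of_eBlockB i b cfg O par hE hM₂ hrepr J y y' hs hE1 ν hx

/-- ★★ **READ, entry 3 ⇒ the majorant of `conj b (Δ_V ∘ O(V))`**, profile `1`, SAME rate. [cite: Balaban1985BackgroundPropagators, Thm 3.3 p.399 with (3.42) p.397 (fourth member); Balaban1984PropagatorsII, (2.51) p.232] -/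
theorem hasMajorant_conj_lapB_O_of_eBlockB (hE : EBlock (kernelFamilyB i B cfg O par) B₀ δ U₁) (hB₀ : 0 ≤ B₀)
    (ιB : BlkY i → IBondY i) (hι : ∀ s, β i.hN i.D i.hk (ιB s) = s)
    {M₂ : ℝ} (hM₂ : 0 ≤ M₂) (hrepr : ∀ (v : 𝔸) (j : ι), |b.repr v j| ≤ M₂ * ‖v‖) :
    HasMajorant (g := toB6 (geo9K i) Rr Hp) (fun p : FBondY i × ι => ιB (blkV1 i.hN i.D p.1))
      (conj b (lapBₗ i (cfg U₁) ∘ₗ (O (cfg U₁)).restrictScalars ℝ))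
      (fun a a' => M₂ * (∑ j, ‖b j‖) * (B₀ * 1 * Real.exp (-(δ * (geo9K i).dist a a')))) :=
  hasMajorant_conj_of_ball_boundB (Rr := Rr) (Hp := Hp) i b (lapBₗ i (cfg U₁) ∘ₗ (O (cfg U₁)).restrictScalars ℝ)
    (fun c Λ => by
      rw [LinearMap.comp_apply, LinearMap.comp_apply, LinearMap.restrictScalars_apply, LinearMap.restrictScalars_apply, map_smul, lapBₗ_apply,
        lapBₗ_apply, lapB_smul])
    ιB hι hM₂ hrepr (fun a a' => B₀ * 1 * Real.exp (-(δ * (geo9K i).dist a a')))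
    (fun _ _ => mul_nonneg (mul_nonneg hB₀ zero_le_one) (Real.exp_pos _).le)
    fun J y y' hs _ hE1 _ hx => by
      rw [LinearMap.comp_apply, lapBₗ_apply]
      exact norm_lapB_O_le_of_eBlockB i b cfg O par hE hM₂ hrepr J y y' hs hE1 hx

end Read

/-! ## §4 The coded bond reading `KACU` of the Sect.-B step of record at a base configuration -/

section Coded

variable {Mstar : ℕ} (G : Subgroup 𝔸ˣ) (x : MemberY d ℓ hd hL b₀ b₁ Mstar) (OA : BondOpY 𝔸 x.toKIdx) (parB : BondParY 𝔸 x.toKIdx)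
  (C37 C38 : ℝ → CfgY 𝔸 x.toKIdx → AfldY 𝔸 x.toKIdx → Prop)

/-- at a base configuration the (3.42) block of the coded U-letter bond reading `KACU` IS the block of def-Y's one-configuration reading `kernelFamilyB`
(`B9SectBStepsKSCU.KACU_members_base`). [cite: Balaban1985BackgroundPropagators, Thm 3.3 p.399 with (3.42) p.397, bookkeeping] -/
theorem eBlock_kernelFamilyB_of_KACU_base {B₀ δ : ℝ} {U : CfgY 𝔸 x.toKIdx} (h : EBlock (KACU G x OA parB C37 C38) B₀ δ (.base U)) :
    EBlock (kernelFamilyB x.toKIdx (bg9Y 𝔸 G x) (fun U => U) OA parB) B₀ δ U := by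
  -- the coded U-letter reading and the pulled-back one-configuration reading have the same (3.42) members at the base
  have h' : EBlock (pullK (codingYx G x C37 C38) (kernelFamilyB x.toKIdx (bg9Y 𝔸 G x) (fun U => U) OA parB)) B₀ δ (.base U) := by
    intro n lam y y' hs
    rw [← (KACU_members_base G x OA parB C37 C38 U).1 n]
    exact h n lam y y' hs
  -- the pulled-back reading at `base U` is the record's at `dec (base U) = U`
  intro n lam y y' hs
  have h1 := h' n lam y y' hs
  simp only [pullK_e, codingYx_dec] at h1
  exact h1

variable [Fintype (geo9K x.toKIdx).Site] {Rr : ℝ} {Hp : Prop} (ιB : BlkY x.toKIdx → IBondY x.toKIdx)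

/-- ★★ **THE FOUR (3.42) BLOCK MAJORANTS OF THE BOND LETTER `OA(U)` READ FROM `KACU` AT A BASE** (def-Y's letters `OA(U)`, `∇_{U,ν} ∘ OA(U)`, `OA(U) ∘ ∇*_{U,ν}`,
`Δ_U ∘ OA(U)` in real coordinates on the bond carrier `FBondY × ι`, block map `ι_B ∘ blkV1`; constants `M₂Σ_j‖b_j‖·B₀`, profiles `ℓ², ℓ, ℓ, 1`, SAME rate; stated over
`geo9K x.toKIdx = geo9Y x` by `rfl`) —
the `h342X` inputs of r06's letter-free G-step `B9Ineq385VG.gExt_leftEntry_of_386` for the G side of `SectBStepU`.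
[cite: Balaban1985BackgroundPropagators, Thm 3.3 p.399 with (3.42) p.397, Thm 3.4 p.400; Balaban1984PropagatorsII, (2.51) p.232] -/
theorem readG342Y_KACU (hι : ∀ s, β x.toKIdx.hN x.toKIdx.D x.toKIdx.hk (ιB s) = s)
    {M₂ : ℝ} (hM₂ : 0 ≤ M₂) (hrepr : ∀ (v : 𝔸) (j : ι), |b.repr v j| ≤ M₂ * ‖v‖)
    {B₀ δ : ℝ} (hB₀ : 0 ≤ B₀) {U : CfgY 𝔸 x.toKIdx} (h : EBlock (KACU G x OA parB C37 C38) B₀ δ (.base U)) :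
    HasMajorant (g := toB6 (geo9K x.toKIdx) Rr Hp) (fun p : FBondY x.toKIdx × ι => ιB (blkV1 x.toKIdx.hN x.toKIdx.D p.1)) (conj b ((OA U).restrictScalars ℝ))
        (fun a a' => M₂ * (∑ j, ‖b j‖) * (B₀ * (geo9K x.toKIdx).len a ^ 2 * Real.exp (-(δ * (geo9K x.toKIdx).dist a a')))) ∧
      (∀ ν : Fin (d + 1), HasMajorant (g := toB6 (geo9K x.toKIdx) Rr Hp) (fun p : FBondY x.toKIdx × ι => ιB (blkV1 x.toKIdx.hN x.toKIdx.D p.1))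
        (conj b (cdBₗ x.toKIdx U ν ∘ₗ (OA U).restrictScalars ℝ))
        (fun a a' => M₂ * (∑ j, ‖b j‖) * (B₀ * (geo9K x.toKIdx).len a * Real.exp (-(δ * (geo9K x.toKIdx).dist a a'))))) ∧
      (∀ ν : Fin (d + 1), HasMajorant (g := toB6 (geo9K x.toKIdx) Rr Hp) (fun p : FBondY x.toKIdx × ι => ιB (blkV1 x.toKIdx.hN x.toKIdx.D p.1))
        (conj b ((OA U).restrictScalars ℝ ∘ₗ cdsBₗ x.toKIdx U ν))
        (fun a a' => M₂ * (∑ j, ‖b j‖) * (B₀ * (geo9K x.toKIdx).len a * Real.exp (-(δ * (geo9K x.toKIdx).dist a a'))))) ∧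
      HasMajorant (g := toB6 (geo9K x.toKIdx) Rr Hp) (fun p : FBondY x.toKIdx × ι => ιB (blkV1 x.toKIdx.hN x.toKIdx.D p.1))
        (conj b (lapBₗ x.toKIdx U ∘ₗ (OA U).restrictScalars ℝ))
        (fun a a' => M₂ * (∑ j, ‖b j‖) * (B₀ * 1 * Real.exp (-(δ * (geo9K x.toKIdx).dist a a')))) := by
  have hE := eBlock_kernelFamilyB_of_KACU_base G x OA parB C37 C38 h
  exact ⟨hasMajorant_conj_O_of_eBlockB (B := bg9Y 𝔸 G x) (U₁ := U) x.toKIdx b (fun U => U) OA parB hE hB₀ ιB hι hM₂ hrepr,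
    fun ν => hasMajorant_conj_cdB_O_of_eBlockB (B := bg9Y 𝔸 G x) (U₁ := U) x.toKIdx b (fun U => U) OA parB hE hB₀ ιB hι hM₂ hrepr ν,
    fun ν => hasMajorant_conj_O_cdsB_of_eBlockB (B := bg9Y 𝔸 G x) (U₁ := U) x.toKIdx b (fun U => U) OA parB hE hB₀ ιB hι hM₂ hrepr ν,
    hasMajorant_conj_lapB_O_of_eBlockB (B := bg9Y 𝔸 G x) (U₁ := U) x.toKIdx b (fun U => U) OA parB hE hB₀ ιB hι hM₂ hrepr⟩

/-! ## §5 WRITE: block majorants of the bond letters at the decoded product ⇒ the (3.42) block of `KACU` at the coded product -/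

omit [Fintype (geo9K x.toKIdx).Site] in
/-- at a coded product the (3.42) members of `KACU` (U-letters: differences at the base `U`, operator at the decoded product `W`) ARE those of def-Y's
one-configuration reading of the CONSTANT letter `OA(W)` over the coded carrier read through `baseY` (`rfl`). [cite: Balaban1985BackgroundPropagators, Thm 3.4 p.400, (3.42) p.397, bookkeeping] -/
theorem KACU_e_prod_eq (n : Fin 4) (U : CfgY 𝔸 x.toKIdx) (a : AfldY 𝔸 x.toKIdx) :
    (KACU G x OA parB C37 C38).e n (.prod U a) =
      (kernelFamilyB x.toKIdx (codingYx G x C37 C38).bg (baseY x.toKIdx) (fun _ => OA (decY x.toKIdx (.prod U a))) parB).e n (.prod U a) := rfl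

/-- ★★ **WRITE FOR `KACU` AT A CODED PRODUCT** (U-letters: covariant differences and the Laplacian at the BASE `U`, the operator at the decoded product
`W = e^{iηa}·U`): block majorants `B_c·ℓ(a)^{(2,1,1,0)}·e^{−δd}` of `conj b G`, `conj b D_ν * conj b G`, `conj b G * conj b D*_ν`, `conj b L * conj b G` — `G`, `D_ν`,
`D*_ν`, `L` any ℝ-linear maps agreeing pointwise with `OA(W)`, `∇_{U,ν}`, `∇*_{U,ν}`, `Δ_U` — give `EBlock (KACU …) (M₂Σ_j‖b_j‖·B_c) δ (prod U a)`, SAME rate.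
Proof: p21's writer `B9CubeLettersInvWriteDictB.eBlock_kernelFamilyBInv_of_hasMajorant` for the auxiliary one-configuration family with the CONSTANT letter
`OA(W)` over the coded carrier at `cfg := baseY` (whose (3.42) members at `prod U a` ARE `KACU`'s, by `rfl`), then the class ⇒ product dictionary
`B9CubeLettersInvReadDictB.eBlock_kernelFamilyB_of_eBlockInvB`. [cite: Balaban1985BackgroundPropagators, Thm 3.3 p.399 with (3.42) p.397, Thm 3.4 p.400, p.403 («of course with different constants»); Balaban1984PropagatorsII, (2.51) p.232] -/
theorem writeG342Y_KACU (hι : ∀ s, β x.toKIdx.hN x.toKIdx.D x.toKIdx.hk (ιB s) = s)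
    {M₂ : ℝ} (hM₂ : 0 ≤ M₂) (hrepr : ∀ (v : 𝔸) (j : ι), |b.repr v j| ≤ M₂ * ‖v‖) (U : CfgY 𝔸 x.toKIdx) (a : AfldY 𝔸 x.toKIdx)
    (Gb : Module.End ℝ (FBondY x.toKIdx → 𝔸)) (hGb : ∀ Λ, Gb Λ = OA (decY x.toKIdx (.prod U a)) Λ)
    (D Ds : Fin (d + 1) → Module.End ℝ (FBondY x.toKIdx → 𝔸)) (hD : ∀ ν Λ, D ν Λ = cdB x.toKIdx U ν Λ)
    (hDs : ∀ ν Λ, Ds ν Λ = cdsB x.toKIdx U ν Λ) (L : Module.End ℝ (FBondY x.toKIdx → 𝔸)) (hL : ∀ Λ, L Λ = lapB x.toKIdx U Λ)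
    {Bc δ : ℝ} (hBc : 0 ≤ Bc)
    (h0 : HasMajorant (g := toB6 (geo9K x.toKIdx) Rr Hp) (fun p : FBondY x.toKIdx × ι => ιB (blkV1 x.toKIdx.hN x.toKIdx.D p.1)) (conj b Gb)
      (fun a a' => Bc * (geo9K x.toKIdx).len a ^ 2 * Real.exp (-(δ * (geo9K x.toKIdx).dist a a'))))
    (h1 : ∀ ν : Fin (d + 1), HasMajorant (g := toB6 (geo9K x.toKIdx) Rr Hp) (fun p : FBondY x.toKIdx × ι => ιB (blkV1 x.toKIdx.hN x.toKIdx.D p.1))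
      (conj b (D ν) * conj b Gb) (fun a a' => Bc * (geo9K x.toKIdx).len a * Real.exp (-(δ * (geo9K x.toKIdx).dist a a'))))
    (h2 : ∀ ν : Fin (d + 1), HasMajorant (g := toB6 (geo9K x.toKIdx) Rr Hp) (fun p : FBondY x.toKIdx × ι => ιB (blkV1 x.toKIdx.hN x.toKIdx.D p.1))
      (conj b Gb * conj b (Ds ν)) (fun a a' => Bc * (geo9K x.toKIdx).len a * Real.exp (-(δ * (geo9K x.toKIdx).dist a a'))))
    (h3 : HasMajorant (g := toB6 (geo9K x.toKIdx) Rr Hp) (fun p : FBondY x.toKIdx × ι => ιB (blkV1 x.toKIdx.hN x.toKIdx.D p.1))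
      (conj b L * conj b Gb) (fun a a' => Bc * 1 * Real.exp (-(δ * (geo9K x.toKIdx).dist a a')))) :
    EBlock (KACU G x OA parB C37 C38) (M₂ * (∑ j, ‖b j‖) * Bc) δ (.prod U a) := by
  -- p21's writer for the auxiliary family with the constant letter `OA(W)` over the coded carrier, read through `baseY`
  have hInv := eBlock_kernelFamilyBInv_of_hasMajorant (Rr := Rr) (Hp := Hp) (i := x.toKIdx) (b := b)
    (O := fun _ => OA (decY x.toKIdx (.prod U a))) (B := (codingYx G x C37 C38).bg) (cfg := baseY x.toKIdx) (par := parB) (U₁ := .prod U a)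
    ιB hι hM₂ hrepr Gb hGb D Ds hD hDs L hL hBc h0 h1 h2 h3
  have hB := eBlock_kernelFamilyB_of_eBlockInvB (B := (codingYx G x C37 C38).bg) (U₁ := .prod U a) x.toKIdx b hM₂ hrepr
    (fun _ => OA (decY x.toKIdx (.prod U a))) (baseY x.toKIdx) parB hInv
  -- the auxiliary family's (3.42) members at `prod U a` ARE `KACU`'s (U-letters at the base `U`, operator at the decoded product)
  intro n lam y y' hs
  rw [KACU_e_prod_eq]
  exact hB n lam y y' hs

end Coded

end Literature.MathematicalPhysics.QuantumFieldTheory.Balaban1983to89.B9SectBGReadY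

end
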